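import Summits.AtomisticToContinuum.BoseEinsteinCondensation.Theorems.GaussianDominationCan.Negative.CruxForms
import Summits.AtomisticToContinuum.BoseEinsteinCondensation.Theorems.GaussianDominationCan.Negative.ProductStatesConst
import Literature.MathematicalPhysics.QuantumManyBody.PeriodicBoseGasFracEnergy

/-!
# Crux `FibreConductance` (stmt-AtomisticToContinuum-9480), line `parseval-shell-bootstrap` —
negative lemma on the stub `stub_shellOccupation`: the half-shell guard is load-bearing

Refuter (drefute) support file for the crux `BECThomsonPrinciple.FibreConductance`.  The hardest
stub of the picked line `Lines/parseval-shell-bootstrap.lean` is `stub_shellOccupation`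
(`def ShellOccupation`): single-mode occupations of `|Φ|` on the resonant shell
`‖p + n‖_∞ < p₁`, `0 < p₁ ≤ min(θ√ρ·L/2π, ‖n‖_∞/2)`, are `≤ K·N/(‖n‖²p₁)`.

Here: the SAME statement with the guard `p₁ ≤ ‖n‖/2` deleted (`ShellOccupationWithoutHalfShell`)
is FALSE, already for the free gas `v = 0` and its exact zero-free minimiser, the constant state:
without the guard the shell radius `p₁ = θ√ρ L/2π` grows with `L` at fixed density, the shell
around `-n` (`n = e₀`) swallows the condensate mode `p = 0`, whose occupation is `N`, while the
claimed bound `K·N/p₁` is `< N` as soon as `p₁ > K`.  So any proof of `stub_shellOccupation` must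
use `p₁ ≤ ‖n‖/2` (it is exactly what keeps `p = 0` out of the shell: `‖0 + n‖ = ‖n‖ ≥ 2p₁ > p₁`),
and the stub cannot be "simplified" by dropping it.  Witness data: `M = 2π`, `T = 1 + 2π(K+1)/θ`,
`N ≥ max(N₀, T⁶/ρ₀, 1)`, `L = N/T²` (so `√(N/L) = T`, window `1/L ≤ √(N/L³)` iff `T ≥ 1`, density
`N ≤ ρ₀L³` iff `T⁶ ≤ ρ₀N²`), `Φ ≡ L^{-3N/2}`, `p₁ = θT/2π`, `p = 0`.  All [folklore].
-/

noncomputable section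

namespace Summit.AtomisticToContinuum.BoseEinsteinCondensation.Theorems.FibreConductance.Negative

open MeasureTheory Literature.MathematicalPhysics.QuantumManyBody.BoseGas
open Summit.AtomisticToContinuum.BoseEinsteinCondensation.Theorems.GaussianDominationCan.Negative
open scoped ENNReal NNReal

/-- `ShellOccupation` of `Lines/parseval-shell-bootstrap.lean` with the half-shell guard
`p₁ ≤ ‖n‖/2` deleted (everything else verbatim). -/
def ShellOccupationWithoutHalfShell : Prop :=
  ∀ v : ℝ → ℝ≥0∞, IsRepulsiveFiniteRange v → (∃ B : ℝ, ∀ r, v r ≤ ENNReal.ofReal B) →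
    ∀ M : ℝ, 0 < M → ∃ θ ρ₀ K : ℝ, 0 < θ ∧ 0 < ρ₀ ∧ 0 < K ∧ ∃ N₀ : ℕ, ∀ m : ℕ, N₀ ≤ m + 1 →
      ∀ L : ℝ, 0 < L → ((m + 1 : ℕ) : ℝ) ≤ ρ₀ * L ^ 3 → ∀ n : Fin 3 → ℤ, n ≠ 0 →
        2 * Real.pi * ‖(fun j => (n j : ℝ))‖ / L ≤ M * Real.sqrt ((m + 1 : ℕ) / L ^ 3) →
          ∀ Φ : PeriodicTrialState (m + 1) L,
            periodicEnergy v Φ = periodicGroundStateEnergy v (m + 1) L → (∀ X, Φ.ψ X ≠ 0) →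
              ∀ p₁ : ℝ, 0 < p₁ → p₁ ≤ θ * Real.sqrt ((m + 1 : ℕ) / L ^ 3) * L / (2 * Real.pi) →
                  ∀ p : Fin 3 → ℤ, ‖(fun j => ((p j + n j : ℤ) : ℝ))‖ < p₁ →
                    cellOccupation (m + 1) L (planeWaveMode L p) (fun X => (‖Φ.ψ X‖ : ℂ)) ≤
                      ENNReal.ofReal (K * (m + 1 : ℕ) / (‖(fun j => (n j : ℝ))‖ ^ 2 * p₁))

/-! ### The constant state: value, modulus, condensate occupation -/

section Const

variable {m : ℕ} {L c : ℝ}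

/-- The constant `N`-body function is the constant `c^N`. [folklore] -/
theorem constFun_apply (m : ℕ) (c : ℝ) (X : Config (m + 1)) :
    constFun m c X = ((c ^ (m + 1) : ℝ) : ℂ) := by
  unfold constFun prodFun constFactor
  rw [Finset.prod_const, Finset.card_univ, Fintype.card_fin]
  push_cast
  rfl

/-- For `c > 0` the modulus of the constant state, recast to `ℂ`, is the constant state itself.
[folklore] -/
theorem norm_constFun_eq (hc : 0 < c) (X : Config (m + 1)) :
    ((‖constFun m c X‖ : ℝ) : ℂ) = constFun m c X := by
  rw [constFun_apply]
  rw [Complex.norm_real, Real.norm_of_nonneg (pow_nonneg hc.le _)]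

/-- **The constant state is fully condensed**: `⟨φ₀, γ φ₀⟩ = N` for `Φ ≡ c^N`, `c²L³ = 1`.
[folklore] -/
theorem cellOccupation_planeWaveMode_zero_constFun (hL : 0 < L) (hc : c ^ 2 * L ^ 3 = 1) :
    cellOccupation (m + 1) L (planeWaveMode L 0) (constFun m c) = (m + 1 : ℕ) := by
  have hL3 : 0 < L ^ 3 := by positivity
  have hc2 : c ^ 2 = (L ^ 3)⁻¹ := by
    field_simp
    linarith [hc]
  rw [cellOccupation_planeWaveMode_zero, condensateOccupation_succ hL]
  -- the slice integral is the constant `L³ c^N`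
  have hslice : ∀ Y : Config m,
      (‖∫ x in cell L, constFun m c (Matrix.vecCons x Y)‖₊ : ℝ≥0∞) ^ 2 =
        ENNReal.ofReal ((L ^ 3 * c ^ (m + 1)) ^ 2) := by
    intro Y
    simp only [constFun_apply]
    rw [integral_cell_const hL, coe_nnnorm_sq_eq_ofReal, norm_mul, Complex.norm_real,
      Real.norm_eq_abs, norm_pow, Complex.norm_real, Real.norm_of_nonneg hL.le]
    congr 1
    rw [mul_pow, mul_pow, sq_abs]
  simp only [hslice]
  rw [setLIntegral_const, volume_cellN, ← ENNReal.ofReal_pow hL.le,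
    ← ENNReal.ofReal_pow hL3.le, (ENNReal.ofReal_inv_of_pos hL3).symm,
    ← ENNReal.ofReal_mul (sq_nonneg _), ← ENNReal.ofReal_mul (inv_nonneg.mpr hL3.le)]
  have key : (L ^ 3)⁻¹ * ((L ^ 3 * c ^ (m + 1)) ^ 2 * (L ^ 3) ^ m) = 1 := by
    have hcm : (c ^ (m + 1)) ^ 2 = ((L ^ 3)⁻¹) ^ (m + 1) := by
      rw [← pow_mul, mul_comm (m + 1) 2, pow_mul, hc2]
    have hL0 : L ≠ 0 := hL.ne'
    rw [mul_pow, hcm]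
    field_simp
    rw [show L ^ 3 * (1 / L ^ 3) ^ (m + 1) * (L ^ 3) ^ m = ((1 / L ^ 3) * L ^ 3) ^ (m + 1) by ring,
      one_div, inv_mul_cancel₀ hL3.ne', one_pow]
  rw [key, ENNReal.ofReal_one, mul_one]
  push_cast
  ring

end Const

/-- `E₀(v = 0) = 0` on the torus (`N ≥ 1`, `L > 0`): the constant state has zero energy. [folklore] -/
theorem periodicGroundStateEnergy_zero_succ (m : ℕ) {L : ℝ} (hL : 0 < L) :
    periodicGroundStateEnergy 0 (m + 1) L = 0 := by
  have hL3 : 0 < L ^ 3 := by positivity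
  have hc : ((Real.sqrt (L ^ 3))⁻¹) ^ 2 * L ^ 3 = 1 := by
    rw [inv_pow, Real.sq_sqrt hL3.le, inv_mul_cancel₀ hL3.ne']
  exact le_antisymm ((periodicGroundStateEnergy_le 0 (constState m hL _ hc)).trans
    (periodicEnergy_constState hL hc).le) bot_le

/-- **The half-shell guard of `stub_shellOccupation` is load-bearing**: with `p₁ ≤ ‖n‖/2` deleted
the statement is false at `v = 0` (constant state, `n = e₀`, `p = 0`, `p₁ = θ√(N/L)/2π > K`).
[folklore] -/
theorem shellOccupation_false_without_halfShell : ¬ ShellOccupationWithoutHalfShell := by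
  intro h
  obtain ⟨θ, ρ₀, K, hθ, hρ₀, hK, N₀, h⟩ :=
    h 0 isRepulsiveFiniteRange_zero ⟨0, fun r => by simp⟩ (2 * Real.pi) (by positivity)
  -- the parameter `T = √(N/L)`
  set T : ℝ := 1 + 2 * Real.pi * (K + 1) / θ with hT
  have hT0 : 0 ≤ 2 * Real.pi * (K + 1) / θ := by positivity
  have hT1 : 1 ≤ T := by linarith
  have hTpos : 0 < T := by linarith
  have hθT : θ * T = θ + 2 * Real.pi * (K + 1) := by rw [hT]; field_simp
  -- the particle number
  obtain ⟨m, hmN₀, hmT⟩ := exists_large N₀ (T ^ 6 / ρ₀ + 1)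
  set N : ℝ := ((m + 1 : ℕ) : ℝ) with hN
  have hN1 : (1 : ℝ) ≤ N := by rw [hN]; exact_mod_cast Nat.succ_le_succ (Nat.zero_le m)
  have hNpos : 0 < N := by linarith
  have hNT : T ^ 6 / ρ₀ ≤ N := by linarith
  -- the side
  set L : ℝ := N / T ^ 2 with hL
  have hLpos : 0 < L := by positivity
  have hL3 : 0 < L ^ 3 := by positivity
  have hNne : N ≠ 0 := hNpos.ne'
  have hTne : T ≠ 0 := hTpos.ne'
  have hsqrt : Real.sqrt (N / L ^ 3) = T ^ 3 / N := by
    rw [show N / L ^ 3 = (T ^ 3 / N) ^ 2 by rw [hL]; field_simp]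
    exact Real.sqrt_sq (by positivity)
  have hsqrtL : Real.sqrt (N / L ^ 3) * L = T := by rw [hsqrt, hL]; field_simp
  -- density `N ≤ ρ₀ L³`
  have hdens : N ≤ ρ₀ * L ^ 3 := by
    have h1 : T ^ 6 ≤ ρ₀ * N := by
      have := (div_le_iff₀ hρ₀).mp hNT
      linarith
    rw [hL, div_pow, mul_div_assoc', le_div_iff₀ (by positivity)]
    calc N * (T ^ 2) ^ 3 = N * T ^ 6 := by ring
      _ ≤ N * (ρ₀ * N) := mul_le_mul_of_nonneg_left h1 hNpos.le
      _ ≤ N * (ρ₀ * N) * N := le_mul_of_one_le_right (by positivity) hN1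
      _ = ρ₀ * N ^ 3 := by ring
  -- window with `M = 2π`, `n = e₀`
  have hwin : 2 * Real.pi * ‖(fun j => ((e0 j : ℤ) : ℝ))‖ / L ≤
      2 * Real.pi * Real.sqrt (N / L ^ 3) := by
    rw [norm_e0, mul_one, hsqrt, hL]
    rw [show 2 * Real.pi / (N / T ^ 2) = 2 * Real.pi * (T ^ 2 / N) by field_simp]
    have hT23 : T ^ 2 ≤ T ^ 3 := pow_le_pow_right₀ hT1 (by norm_num)
    gcongr
  -- the constant state
  have hc : ((Real.sqrt (L ^ 3))⁻¹) ^ 2 * L ^ 3 = 1 := by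
    rw [inv_pow, Real.sq_sqrt hL3.le, inv_mul_cancel₀ hL3.ne']
  have hcpos : 0 < (Real.sqrt (L ^ 3))⁻¹ := by positivity
  have hE : periodicEnergy 0 (constState m hLpos _ hc) = periodicGroundStateEnergy 0 (m + 1) L := by
    rw [periodicEnergy_constState hLpos hc, periodicGroundStateEnergy_zero_succ m hLpos]
  have hz : ∀ X, (constState m hLpos _ hc).ψ X ≠ 0 := by
    intro X
    show constFun m _ X ≠ 0
    rw [constFun_apply]
    exact_mod_cast (pow_pos hcpos _).ne'
  -- the shell radius
  set p₁ : ℝ := θ * Real.sqrt (N / L ^ 3) * L / (2 * Real.pi) with hp₁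
  have hp₁T : p₁ = θ * T / (2 * Real.pi) := by rw [hp₁, mul_assoc θ, hsqrtL]
  have hp₁pos : 0 < p₁ := by rw [hp₁T]; positivity
  have hp₁K : K < p₁ := by
    rw [hp₁T, hθT, lt_div_iff₀ (by positivity)]
    nlinarith [Real.pi_pos, hθ, hK]
  have hp₁1 : 1 < p₁ := by
    rw [hp₁T, hθT, lt_div_iff₀ (by positivity)]
    nlinarith [Real.pi_pos, hθ, hK, mul_pos hK Real.pi_pos]
  -- the shell contains `p = 0`
  have hshell : ‖(fun j => (((0 : Fin 3 → ℤ) j + e0 j : ℤ) : ℝ))‖ < p₁ := by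
    have : (fun j => (((0 : Fin 3 → ℤ) j + e0 j : ℤ) : ℝ)) = fun j => ((e0 j : ℤ) : ℝ) := by
      funext j; simp
    rw [this, norm_e0]
    exact hp₁1
  have key := h m hmN₀ L hLpos hdens e0 e0_ne_zero hwin (constState m hLpos _ hc) hE hz p₁ hp₁pos
    le_rfl 0 hshell
  -- occupation of the condensate is `N`, the claimed bound is `K N / p₁ < N`
  have hmod : (fun X => ((‖(constState m hLpos _ hc).ψ X‖ : ℝ) : ℂ)) =
      constFun m (Real.sqrt (L ^ 3))⁻¹ := by
    funext X
    exact norm_constFun_eq hcpos X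
  rw [hmod, cellOccupation_planeWaveMode_zero_constFun hLpos hc, norm_e0, one_pow, one_mul] at key
  have hlt : K * N / p₁ < N := by
    rw [div_lt_iff₀ hp₁pos]
    nlinarith
  have hlt' : ENNReal.ofReal (K * N / p₁) < ((m + 1 : ℕ) : ℝ≥0∞) := by
    rw [← ENNReal.ofReal_natCast]
    exact (ENNReal.ofReal_lt_ofReal_iff hNpos).mpr hlt
  exact absurd key (not_le.mpr hlt')

end Summit.AtomisticToContinuum.BoseEinsteinCondensation.Theorems.FibreConductance.Negative

end
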